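import Summits.ABC.IUTFork.LDHGenuineTowerArithPinned
import Summits.ABC.IUTFork.LDHGenuinePerImageExplicit
import HarnessLib

/-!
# The fork at [IUTchIII] Corollary 3.12, L-DH level: S-b at the genuine datum in the PER-IMAGE reading (display-P
# line) with the classical tower facts discharged — `HullEstimatePerImageOf T (B_III P l)` modulo the (R4) e-term only

Record-only file (D-0012) of the abc-iut cell (campaign-S seat abc-iut-S3, S-b holder, stmt-ABC-19678 line «display-P»);
TAKES NO SIDE on [IUTchIII] Cor. 3.12 or on the reading (U)/(P) of `−|log(Θ)|`. Mochizuki, *Inter-universal Teichmüller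
theory IV* (RIMS manuscript Apr. 2020), Thm. 1.10 proof Steps (ii) p. 24, (iii) pp. 25–26, (v) pp. 27–29.

Sequel to `LDHGenuineTowerArithPinned.lean` (`deltaExplicit_le_BIII_pinned`: the explicit Step (v) constant of a genuine
datum is `≤ B_III(P, l)` with every classical tower fact discharged). Here it is composed with abc-iut-S7's
`DHData.hullEstimatePerImageOf_ofInput_explicit` (the per-image hull estimate for EVERY input, no slot term):
* `PointDict.hullEstimatePerImageOf_BIII_pinned (T) (hP) (h7) (hR4) : T.HullEstimatePerImageOf (B_III P l)` — modulo the
  (R4) e-term input (γ) ONLY (abc-iut-S1's lane, `e_mod := d_mod`);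
* `PointDict.hullVolumePerImageAtDatum_BIII_pinned` — the `∀ T` form = the body of the registered stub
  `stub_hullVolumePerImage` at an admissible `(P, l)`, `l ≥ 7`, modulo (γ).
[cite: Mochizuki2012, IUTchIV Thm. 1.10 proof Steps (ii)–(v) p. 24–29] [claim: Mochizuki2012, status: disputed] for every
IUT quotation. Nothing here asserts (γ), Cor. 3.12, or a reading of it, for any point.
-/

noncomputable section

namespace Summit.ABC.IUTFork

open Literature.IUT.HodgeTheaters Literature.IUT.LogVolume NumberField IsDedekindDomain
open Literature.NumberTheory.DiophantineGeometry.GenEll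
open scoped Nat.Prime

namespace PointDict

variable {P : NFPoint} {l : ℕ}

/-- `log((2^12·3^3·5·d)·l) ≥ 0` for `d, l ≥ 1`. [cite: Mochizuki2012, IUTchIV Thm. 1.10 p. 22] -/
private theorem log_dstar_mul_nonnegP {d l : ℕ} (hd : 1 ≤ d) (hl : 1 ≤ l) :
    0 ≤ Real.log (((2 ^ 12 * 3 ^ 3 * 5 * d : ℕ) : ℝ) * l) := by
  apply Real.log_nonneg
  have h1 : (1 : ℝ) ≤ ((2 ^ 12 * 3 ^ 3 * 5 * d : ℕ) : ℝ) := by exact_mod_cast (by nlinarith : 1 ≤ 2 ^ 12 * 3 ^ 3 * 5 * d)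
  have h2 : (1 : ℝ) ≤ (l : ℝ) := by exact_mod_cast hl
  nlinarith

/-- **S-b AT THE DATUM, reading (P): `T.HullEstimatePerImageOf (B_III P l)` modulo the (R4) e-term ONLY** — abc-iut-S7's
`hullEstimatePerImageOf_ofInput_explicit` (every input, no slot term) composed with `deltaExplicit_le_BIII_pinned`: the
body of the display-P line's `stub_hullVolumePerImage` at an admissible `(P, l)` with every classical input but the
e-term discharged. [cite: Mochizuki2012, IUTchIV Thm. 1.10 proof Steps (ii)–(v) p. 24–29] [claim: Mochizuki2012, status: disputed] -/
theorem hullEstimatePerImageOf_BIII_pinned (T : Cor22.ThetaVolumeDatumAt P l) (hP : P ∈ UP) (h7 : 7 ≤ l)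
    (hR4 : letI := T.instFieldF; letI := T.instNumberFieldF; letI := T.instFieldK; letI := T.instNumberFieldK
      letI := T.instAlgebraK; letI := T.instIsElliptic
      ∀ (p : ℕ) [hp : Fact p.Prime], p ∈ T.I.supportPrimes → ∀ v : placesOver (fieldOfModuli T.E) p,
        p - 2 < absRamificationIdx p ((T.I.σ.localFieldFamily p hp.out).k v) →
          p ≤ 2 ^ 12 * 3 ^ 3 * 5 * Cor22.dmod P * l ∧
            3 + Real.log (absRamificationIdx p ((T.I.σ.localFieldFamily p hp.out).k v)) ≤
              4 * Real.log (((2 ^ 12 * 3 ^ 3 * 5 * Cor22.dmod P : ℕ) : ℝ) * l)) :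
    T.HullEstimatePerImageOf (((l : ℝ) + 1) / 4 * ((1 + 12 * (Cor22.dmod P : ℝ) / l)
      * (P.logDiff + Cor22.logCondAvoid P {2, l}) + 2 * Real.log l + 52
        + 20 / 3 * Real.log (((2 ^ 12 * 3 ^ 3 * 5 * Cor22.dmod P : ℕ) : ℝ) * (l : ℝ))
          * (Nat.primeCounting (2 ^ 12 * 3 ^ 3 * 5 * Cor22.dmod P * l) : ℝ))) := by
  classical
  letI := T.instFieldF; letI := T.instNumberFieldF; letI := T.instAlgebraF; letI := T.instFieldK
  letI := T.instNumberFieldK; letI := T.instAlgebraK; letI := T.instFieldFbar; letI := T.instAlgebraFbar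
  letI := T.instAlgebraKFbar; letI := T.instIsElliptic
  have hl1 : 1 ≤ l := by omega
  have hd : 1 ≤ Cor22.dmod P := Cor22.dmod_pos P
  have hXl : ((T.I.X.l : ℕ) : ℝ) = (l : ℝ) := by exact_mod_cast T.isVolumeInputOf.l_eq
  have h0 := DHData.hullEstimatePerImageOf_ofInput_explicit T.I (2 ^ 12 * 3 ^ 3 * 5 * Cor22.dmod P * l)
    (log_dstar_mul_nonnegP hd hl1) hR4
  rw [hXl] at h0
  unfold Cor22.ThetaVolumeDatumAt.HullEstimatePerImageOf
  exact T.I.hullEstimatePerImageOf_mono h0 (deltaExplicit_le_BIII_pinned T hP h7)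

/-- **`Cor22.HullVolumePerImageAtDatum P l (B_III P l)` modulo the (R4) e-term at every datum** (the `∀ T` form,
reading (P)): the display-P line's `stub_hullVolumePerImage` body at an admissible `(P, l)`, `l ≥ 7`, modulo the
e-term only. [cite: Mochizuki2012, IUTchIV Thm. 1.10 proof Steps (ii)–(v) p. 24–29] [claim: Mochizuki2012, status: disputed] -/
theorem hullVolumePerImageAtDatum_BIII_pinned (hP : P ∈ UP) (h7 : 7 ≤ l)
    (hR4 : ∀ T : Cor22.ThetaVolumeDatumAt P l,
      letI := T.instFieldF; letI := T.instNumberFieldF; letI := T.instFieldK; letI := T.instNumberFieldK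
      letI := T.instAlgebraK; letI := T.instIsElliptic
      ∀ (p : ℕ) [hp : Fact p.Prime], p ∈ T.I.supportPrimes → ∀ v : placesOver (fieldOfModuli T.E) p,
        p - 2 < absRamificationIdx p ((T.I.σ.localFieldFamily p hp.out).k v) →
          p ≤ 2 ^ 12 * 3 ^ 3 * 5 * Cor22.dmod P * l ∧
            3 + Real.log (absRamificationIdx p ((T.I.σ.localFieldFamily p hp.out).k v)) ≤
              4 * Real.log (((2 ^ 12 * 3 ^ 3 * 5 * Cor22.dmod P : ℕ) : ℝ) * l)) :
    Cor22.HullVolumePerImageAtDatum P l (((l : ℝ) + 1) / 4 * ((1 + 12 * (Cor22.dmod P : ℝ) / l)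
      * (P.logDiff + Cor22.logCondAvoid P {2, l}) + 2 * Real.log l + 52
        + 20 / 3 * Real.log (((2 ^ 12 * 3 ^ 3 * 5 * Cor22.dmod P : ℕ) : ℝ) * (l : ℝ))
          * (Nat.primeCounting (2 ^ 12 * 3 ^ 3 * 5 * Cor22.dmod P * l) : ℝ))) :=
  fun T => hullEstimatePerImageOf_BIII_pinned T hP h7 (hR4 T)

end PointDict

end Summit.ABC.IUTFork

end
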